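/-
COR-CM (cell pub-hodgecm2 = stage 2 of the Hodge ladder), seat b26 gen 20 (prover-pub-hodgecm2-b26-g20-0, 2026-08-21);
count-neutral for the binder table (no row).  Lane CM-FIELD-POWERS, part 6: `End⁰` of `∏ᵢ Bᵢ^{nᵢ+1}` for pairwise
orthogonal (e.g. simple, pairwise non-isogenous) `Bᵢ` — Mumford §19 p. 174 assembled; CM case.  Theorems only.
-/
import Summits.HodgeConjecture.CorCM.IsotypicCMEndAlgebra
import Literature.AlgebraicGeometry.Motives.AbelianVarietyEndAlgebraOrthogonalBiproduct
import HarnessLib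

/-!
# `End⁰(⨁ᵢ Bᵢ^{nᵢ+1}) ≅ ∏ᵢ Mat_{nᵢ+1}(End⁰ Bᵢ)`: dimension and commutativity; the CM case

D. Mumford, *Abelian Varieties* (1970), §19 p. 174: for `X ∼ A₁^{n₁} × ⋯ × A_k^{n_k}` with the `Aᵢ`
simple and pairwise non-isogenous, «`End⁰(X) = ⊕ᵢ M_{nᵢ}(Dᵢ)`, `Dᵢ = End⁰(Aᵢ)`» (G. Shimura, *Abelian
Varieties with Complex Multiplication and Modular Functions* (1998), §5.1, proof of Prop. 3: «`End_Q(A)`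
is identified with the direct sum of the `ℜᵢ`», `ℜᵢ` the total matrix ring of degree `hᵢ` over
`End_Q(Aᵢ)`).  The two halves are in the tree: `End⁰` of an ORTHOGONAL biproduct is the product of the
`End⁰` (`Motives/AbelianVarietyEndAlgebraOrthogonalBiproduct`), and `End⁰(B^m) ≅ Mat_m(End⁰ B)`
(`CorCM/EndAlgebraPowerMatrix`).  This file assembles them for the biproduct of powers
`X = ⨁ᵢ ⨁_{Fin (nᵢ+1)} Bᵢ` of a finite orthogonal family `B` over any field:

* `orthogonal_biproduct_powers` — the blocks `Bⱼ^{nⱼ+1}`, `Bₗ^{nₗ+1}` (`j ≠ l`) are orthogonal;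
* `finrank_endAlgebra_biproduct_powers` — `dim_ℚ End⁰(X) = Σᵢ (nᵢ+1)² dim_ℚ End⁰(Bᵢ)`;
* `endAlgebra_biproduct_powers_comm_iff` — `End⁰(X)` is commutative iff every `nᵢ = 0` and every
  `End⁰(Bᵢ)` is commutative (`dim Bᵢ > 0`);
and, over `ℂ`, for `Bᵢ` with `End⁰(Bᵢ)` a field of degree `2 dim Bᵢ` (`Milne1999.IsOfCMTypeSimple`,
simple CM) pairwise non-isogenous and `A ∼ X` (every CM abelian variety is of this form up to isogeny,
Milne 1999 §2 p. 54):
* `finrank_endAlgebra_of_isIsogenous_cmPowers` — `dim_ℚ End⁰(A) = Σᵢ (nᵢ+1)² · 2 dim Bᵢ`;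
* `two_mul_dim_le_finrank_endAlgebra_of_isIsogenous_cmPowers` — `2 dim A ≤ dim_ℚ End⁰(A)`, with
  equality iff all `nᵢ = 0` (`finrank_endAlgebra_eq_two_mul_dim_iff`);
* `endAlgebra_comm_iff_of_isIsogenous_cmPowers` — `End⁰(A)` is commutative iff all `nᵢ = 0`, i.e. iff
  `A` is isogenous to a product of pairwise non-isogenous simple CM abelian varieties.

## References
* [MumfordAV1970] D. Mumford, *Abelian Varieties* (1970), §19 Cor. 2 of Thm. 3 and p. 174.
* [Shimura1998] G. Shimura, *Abelian Varieties with Complex Multiplication and Modular Functions* (1998),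
  §5.1 Propositions 1, 3, 4, 6 (held chunks p0046–p0050).
* [Milne1999] J. S. Milne, *Lefschetz motives and the Tate conjecture*, Compositio Math. 117 (1999), §2 p. 54.
-/

noncomputable section

open CategoryTheory CategoryTheory.Limits

namespace Summit.HodgeConjecture.CorCM.CMProductEnd

open Literature.AlgebraicGeometry.Motives Literature.AlgebraicGeometry.Motives.AbelianVariety
open Literature.AlgebraicGeometry.ComplexMultiplication
open Literature.AlgebraicGeometry.Milne1999 (IsOfCMType IsOfCMTypeSimple)
open Summit.HodgeConjecture.CorCM.AndreRiemann Summit.HodgeConjecture.CorCM.EndAlgebraPower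
open Summit.HodgeConjecture.CorCM.IsotypicCM

universe u

/-! ## §1 Any field: `End⁰` of a biproduct of powers of an orthogonal family -/

section AnyField

variable {k : Type u} [Field k] {ι : Type} [Fintype ι] [DecidableEq ι]
  {B : ι → AbelianVariety k} {n : ι → ℕ}

omit [Fintype ι] [DecidableEq ι] in
/-- The powers `Bⱼ^{nⱼ+1}`, `Bₗ^{nₗ+1}` of orthogonal `Bⱼ`, `Bₗ` are orthogonal.
[cite: MumfordAV1970, §19 (p. 174)] -/
theorem orthogonal_biproduct_powers (horth : ∀ j l, j ≠ l → ∀ f : B j ⟶ B l, f = 0) :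
    ∀ j l, j ≠ l →
      ∀ f : (⨁ fun _ : Fin (n j + 1) => B j) ⟶ (⨁ fun _ : Fin (n l + 1) => B l), f = 0 :=
  fun j l hjl f => hom_biproduct_eq_zero (fun _ _ g => horth j l hjl g) f

/-- **`dim_ℚ End⁰(⨁ᵢ Bᵢ^{nᵢ+1}) = Σᵢ (nᵢ+1)² dim_ℚ End⁰(Bᵢ)`** for an orthogonal family `B` (Mumford:
`End⁰ = ⊕ᵢ M_{nᵢ}(Dᵢ)`). [cite: MumfordAV1970, §19 (p. 174)] [cite: Shimura1998, §5.1 (proof of Proposition 3)] -/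
theorem finrank_endAlgebra_biproduct_powers (horth : ∀ j l, j ≠ l → ∀ f : B j ⟶ B l, f = 0) :
    Module.finrank ℚ (⨁ fun i => ⨁ fun _ : Fin (n i + 1) => B i).endAlgebra =
      ∑ i, (n i + 1) ^ 2 * Module.finrank ℚ (B i).endAlgebra := by
  rw [finrank_endAlgebra_biproduct_eq_sum (orthogonal_biproduct_powers horth)]
  exact Finset.sum_congr rfl fun i _ => finrank_endAlgebra_biproduct (B i) (n i + 1)

/-- `End⁰(⨁_{Fin 1} B) ≅ End⁰(B)`: commutativity transfers (`⨁_{Fin 1} B ∼ B`).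
[cite: MumfordAV1970, §19 (p. 174)] -/
theorem endAlgebra_biproduct_fin_one_comm_iff (B : AbelianVariety k) :
    (∀ x y : (⨁ fun _ : Fin (0 + 1) => B).endAlgebra, x * y = y * x) ↔
      ∀ x y : B.endAlgebra, x * y = y * x := by
  have h : IsIsogenous (⨁ fun _ : Fin (0 + 1) => B) B := by
    have := isIsogenous_biproduct_powSucc B 0
    rwa [AbelianVariety.powSucc_zero] at this
  exact h.endAlgebra_comm_iff

/-- **`End⁰(⨁ᵢ Bᵢ^{nᵢ+1})` is commutative iff every `nᵢ = 0` and every `End⁰(Bᵢ)` is commutative**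
(orthogonal family, `dim Bᵢ > 0`: a matrix ring `Mat_m(D)`, `m ≥ 2`, `D ≠ 0`, is not commutative).
[cite: MumfordAV1970, §19 (p. 174)] -/
theorem endAlgebra_biproduct_powers_comm_iff (horth : ∀ j l, j ≠ l → ∀ f : B j ⟶ B l, f = 0)
    (hB : ∀ i, 0 < (B i).dim) :
    (∀ x y : (⨁ fun i => ⨁ fun _ : Fin (n i + 1) => B i).endAlgebra, x * y = y * x) ↔
      (∀ i, n i = 0) ∧ ∀ i, ∀ x y : (B i).endAlgebra, x * y = y * x := by
  rw [endAlgebra_biproduct_comm_iff (orthogonal_biproduct_powers horth)]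
  constructor
  · intro h
    have hn : ∀ i, n i = 0 := fun i => by
      by_contra hi
      obtain ⟨x, y, hxy⟩ := exists_mul_ne_mul_endAlgebra_biproduct (m := n i + 1) (hB i) (by omega)
      exact hxy (h i x y)
    refine ⟨hn, fun i => ?_⟩
    have hi := h i
    rw [hn i] at hi
    exact (endAlgebra_biproduct_fin_one_comm_iff (B i)).1 hi
  · rintro ⟨hn, hc⟩ i
    rw [hn i]
    exact (endAlgebra_biproduct_fin_one_comm_iff (B i)).2 (hc i)

end AnyField

/-! ## §2 Over `ℂ`: products of powers of pairwise non-isogenous simple CM abelian varieties -/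

section Complex

/-- Arithmetic: `2 (m+1) d ≤ (m+1)² · 2d`. [folklore] -/
private theorem two_mul_le_sq_mul (m d : ℕ) : 2 * ((m + 1) * d) ≤ (m + 1) ^ 2 * (2 * d) := by
  have key : (m + 1) ^ 2 * (2 * d) = 2 * ((m + 1) * d) + m * (2 * ((m + 1) * d)) := by ring
  omega

/-- Arithmetic: `2 (m+1) d = (m+1)² · 2d` with `d > 0` forces `m = 0`. [folklore] -/
private theorem eq_zero_of_two_mul_eq_sq_mul {m d : ℕ} (hd : 0 < d)
    (h : 2 * ((m + 1) * d) = (m + 1) ^ 2 * (2 * d)) : m = 0 := by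
  have key : (m + 1) ^ 2 * (2 * d) = 2 * ((m + 1) * d) + m * (2 * ((m + 1) * d)) := by ring
  rw [key] at h
  have hm : m * (2 * ((m + 1) * d)) = 0 := by omega
  rcases Nat.mul_eq_zero.1 hm with h0 | h0
  · exact h0
  · exfalso
    have : 0 < 2 * ((m + 1) * d) := by positivity
    omega

variable {r : ℕ} {B : Fin r → AbelianVariety ℂ} {n : Fin r → ℕ} {A : AbelianVariety ℂ}

/-- Pairwise non-isogenous `Bᵢ` with `End⁰(Bᵢ)` fields (hence simple) are orthogonal.
[cite: MumfordAV1970, §19 Cor. 2 of Thm. 3] -/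
theorem orthogonal_of_isOfCMTypeSimple (hB : ∀ i, IsOfCMTypeSimple (B i))
    (hni : ∀ j l, j ≠ l → ¬ IsIsogenous (B j) (B l)) :
    ∀ j l, j ≠ l → ∀ f : B j ⟶ B l, f = 0 :=
  orthogonal_of_isSimple_of_not_isIsogenous (fun i => isSimple_of_isField_endAlgebra (hB i).1) hni

/-- `dim (⨁ᵢ Bᵢ^{nᵢ+1}) = Σᵢ (nᵢ+1) dim Bᵢ`. [cite: MumfordAV1970, §19] -/
theorem dim_biproduct_powers :
    (⨁ fun i => ⨁ fun _ : Fin (n i + 1) => B i).dim = ∑ i, (n i + 1) * (B i).dim := by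
  rw [dim_biproduct_fin]
  exact Finset.sum_congr rfl fun i _ => dim_biproduct_const (B i) (n i + 1)

/-- **`dim_ℚ End⁰(A) = Σᵢ (nᵢ+1)² · 2 dim Bᵢ`** for `A ∼ ⨁ᵢ Bᵢ^{nᵢ+1}`, `Bᵢ` pairwise non-isogenous with
`End⁰(Bᵢ)` a field of degree `2 dim Bᵢ` (Mumford `⊕ M_{nᵢ}(Dᵢ)` with `Dᵢ = Kᵢ` a CM field, Shimura
§5.1 Prop. 6: `g = 1`). [cite: MumfordAV1970, §19 (p. 174)] [cite: Shimura1998, §5.1 Propositions 4 and 6] -/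
theorem finrank_endAlgebra_of_isIsogenous_cmPowers (hB : ∀ i, IsOfCMTypeSimple (B i))
    (hni : ∀ j l, j ≠ l → ¬ IsIsogenous (B j) (B l))
    (hA : IsIsogenous A (⨁ fun i => ⨁ fun _ : Fin (n i + 1) => B i)) :
    Module.finrank ℚ A.endAlgebra = ∑ i, (n i + 1) ^ 2 * (2 * (B i).dim) := by
  rw [hA.finrank_endAlgebra_eq, finrank_endAlgebra_biproduct_powers (orthogonal_of_isOfCMTypeSimple hB hni)]
  exact Finset.sum_congr rfl fun i _ => by rw [(hB i).2]

/-- **`2 dim A ≤ dim_ℚ End⁰(A)`** for such `A` (`Σ (nᵢ+1) 2 dim Bᵢ ≤ Σ (nᵢ+1)² 2 dim Bᵢ`).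
[cite: Shimura1998, §5.1 Propositions 1, 4 and 6] -/
theorem two_mul_dim_le_finrank_endAlgebra_of_isIsogenous_cmPowers (hB : ∀ i, IsOfCMTypeSimple (B i))
    (hni : ∀ j l, j ≠ l → ¬ IsIsogenous (B j) (B l))
    (hA : IsIsogenous A (⨁ fun i => ⨁ fun _ : Fin (n i + 1) => B i)) :
    2 * A.dim ≤ Module.finrank ℚ A.endAlgebra := by
  obtain ⟨u, hu⟩ := hA
  rw [finrank_endAlgebra_of_isIsogenous_cmPowers hB hni ⟨u, hu⟩, dim_eq_of_isIsogeny hu,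
    dim_biproduct_powers, Finset.mul_sum]
  exact Finset.sum_le_sum fun i _ => two_mul_le_sq_mul (n i) (B i).dim

/-- **`dim_ℚ End⁰(A) = 2 dim A` iff all `nᵢ = 0`** (iff `A` is isogenous to a product of pairwise
non-isogenous simple CM abelian varieties; `dim Bᵢ > 0`). [cite: Shimura1998, §5.1 Propositions 1, 4 and 6] -/
theorem finrank_endAlgebra_eq_two_mul_dim_iff (hB : ∀ i, IsOfCMTypeSimple (B i))
    (hni : ∀ j l, j ≠ l → ¬ IsIsogenous (B j) (B l))
    (hA : IsIsogenous A (⨁ fun i => ⨁ fun _ : Fin (n i + 1) => B i)) :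
    Module.finrank ℚ A.endAlgebra = 2 * A.dim ↔ ∀ i, n i = 0 := by
  obtain ⟨u, hu⟩ := hA
  have hd : ∀ i, 0 < (B i).dim := fun i => dim_pos_of_isOfCMTypeSimple (hB i)
  rw [finrank_endAlgebra_of_isIsogenous_cmPowers hB hni ⟨u, hu⟩, dim_eq_of_isIsogeny hu,
    dim_biproduct_powers, Finset.mul_sum]
  constructor
  · intro h
    -- termwise `(nᵢ+1)·2dᵢ ≤ (nᵢ+1)²·2dᵢ`; equality of the sums forces termwise equality
    have hle : ∀ i ∈ Finset.univ, 2 * ((n i + 1) * (B i).dim) ≤ (n i + 1) ^ 2 * (2 * (B i).dim) :=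
      fun i _ => two_mul_le_sq_mul (n i) (B i).dim
    have heq := (Finset.sum_eq_sum_iff_of_le hle).1 h.symm
    exact fun i => eq_zero_of_two_mul_eq_sq_mul (hd i) (heq i (Finset.mem_univ i))
  · intro h
    exact Finset.sum_congr rfl fun i _ => by rw [h i]; ring

/-- **`End⁰(A)` is commutative iff all `nᵢ = 0`** for `A ∼ ⨁ᵢ Bᵢ^{nᵢ+1}` with `Bᵢ` pairwise non-isogenous
simple CM: an abelian variety of CM-type has commutative `End⁰` exactly when its simple factors occur with
multiplicity one. [cite: MumfordAV1970, §19 (p. 174)] [cite: Shimura1998, §5.1 Propositions 3, 4 and 6] -/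
theorem endAlgebra_comm_iff_of_isIsogenous_cmPowers (hB : ∀ i, IsOfCMTypeSimple (B i))
    (hni : ∀ j l, j ≠ l → ¬ IsIsogenous (B j) (B l))
    (hA : IsIsogenous A (⨁ fun i => ⨁ fun _ : Fin (n i + 1) => B i)) :
    (∀ x y : A.endAlgebra, x * y = y * x) ↔ ∀ i, n i = 0 := by
  rw [hA.endAlgebra_comm_iff, endAlgebra_biproduct_powers_comm_iff (orthogonal_of_isOfCMTypeSimple hB hni)
    fun i => dim_pos_of_isOfCMTypeSimple (hB i)]
  exact ⟨fun h => h.1, fun h => ⟨h, fun i x y => (hB i).1.mul_comm x y⟩⟩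

/-- **Equivalently: `End⁰(A)` is commutative iff `dim_ℚ End⁰(A) = 2 dim A`** (for such `A`).
[cite: Shimura1998, §5.1 Propositions 1, 3, 4 and 6] -/
theorem endAlgebra_comm_iff_finrank_eq_two_mul_dim (hB : ∀ i, IsOfCMTypeSimple (B i))
    (hni : ∀ j l, j ≠ l → ¬ IsIsogenous (B j) (B l))
    (hA : IsIsogenous A (⨁ fun i => ⨁ fun _ : Fin (n i + 1) => B i)) :
    (∀ x y : A.endAlgebra, x * y = y * x) ↔ Module.finrank ℚ A.endAlgebra = 2 * A.dim := by
  rw [endAlgebra_comm_iff_of_isIsogenous_cmPowers hB hni hA, finrank_endAlgebra_eq_two_mul_dim_iff hB hni hA]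

end Complex

end Summit.HodgeConjecture.CorCM.CMProductEnd

end
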